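import Literature.MathematicalPhysics.QuantumLattice.FermionOperatorsProofs
import Literature.MathematicalPhysics.QuantumLattice.SectorVariationalBounds
import HarnessLib

/-!
# Residual bounds for rounded certificates: contractions and `‖Σ aₖ Mₖ‖ ≤ Σ |aₖ|`

Family `hubbard` (trunk T-QLATTICE). The one analytic step of a ROUNDED bootstrap / SOS certificate
that is not an identity check: after rounding, `H − c·1 − K − Σ G_ab O_a†O_b = R` with an exactly
known residual `R = Σₖ aₖ Mₖ`, a linear combination of normal-ordered fermionic monomials `Mₖ`; one
needs `R + ε·1 ⪰ 0` with `ε = Σₖ |aₖ|` (Kull–Schuch–Dive–Navascués 2024 §5.3, "modify [the dual] to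
make it strictly feasible"; the cell's paper §4: "every normal-ordered fermionic monomial has operator
norm ≤ 1, ‖R‖ ≤ Σ|coeff(R)| =: ε"). This file PROVES that step by elementary quadratic-form algebra
(no operator norms, no Cauchy–Schwarz):

* `Matrix.IsContraction M :↔ 1 − Mᴴ M ⪰ 0`; closed under products (`IsContraction.mul`), unit
  scalars (`IsContraction.smul_of_norm_le_one`), contains `0`, `1`;
* `IsContraction.neg_re_le_re_quadForm`: `−Re⟨v,v⟩ ≤ Re⟨v, M v⟩` (expand `0 ≤ ‖v + Mv‖²`), and with
  a phase, `IsContraction.neg_norm_mul_le` : `−‖a‖·Re⟨v,v⟩ ≤ Re (a·⟨v, M v⟩)`;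
* `posSemidef_sum_smul_add_of_isContraction`: for contractions `Mₖ` and coefficients `aₖ` with
  `Σ aₖ Mₖ` Hermitian, `Σₖ aₖ Mₖ + (Σₖ ‖aₖ‖)·1 ⪰ 0`;
* fermions: `isContraction_annihilation`, `isContraction_creation` (from the CAR
  `c c† + c† c = 1`), hence every product of creation / annihilation matrices is a contraction
  (`isContraction_list_prod`).

Everything is PROVED; no named fact is introduced.

## References
* I. Kull, N. Schuch, B. Dive, M. Navascués, PRX 14 (2024) 021008, §5.3. [cite: KullEtAl2024, §5.3]
* O. Bratteli, D. W. Robinson, *Operator Algebras and Quantum Statistical Mechanics 2*, §5.2.2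
  (`‖a(f)‖ = ‖f‖` from the CAR). [cite: BratteliRobinsonII1997, §5.2.2]
-/

noncomputable section

open scoped ComplexOrder BigOperators

namespace Matrix

variable {n : Type*} [Fintype n] [DecidableEq n]

/-- (Dot-notation extension of Mathlib's `Matrix`.) `M` is a contraction: `1 − Mᴴ M ⪰ 0`, i.e.
`‖M v‖ ≤ ‖v‖` for all `v`. [folklore] -/
def IsContraction (M : Matrix n n ℂ) : Prop := ((1 : Matrix n n ℂ) - Mᴴ * M).PosSemidef

/-- `‖M v‖² ≤ ‖v‖²` for a contraction (as complex numbers in the star order). [folklore] -/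
theorem IsContraction.star_mulVec_dotProduct_le {M : Matrix n n ℂ} (hM : M.IsContraction) (v : n → ℂ) :
    star (M *ᵥ v) ⬝ᵥ (M *ᵥ v) ≤ star v ⬝ᵥ v := by
  have h := hM.dotProduct_mulVec_nonneg v
  rw [sub_mulVec, dotProduct_sub, one_mulVec, ← mulVec_mulVec, dotProduct_mulVec, ← star_mulVec]
    at h
  exact sub_nonneg.mp h

/-- The identity is a contraction. [folklore] -/
theorem isContraction_one : (1 : Matrix n n ℂ).IsContraction := by
  rw [IsContraction, conjTranspose_one, mul_one, sub_self]
  exact PosSemidef.zero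

/-- Zero is a contraction. [folklore] -/
theorem isContraction_zero : (0 : Matrix n n ℂ).IsContraction := by
  rw [IsContraction, mul_zero, sub_zero]
  exact PosSemidef.one

/-- **Products of contractions are contractions**:
`1 − (AB)ᴴ AB = (1 − BᴴB) + Bᴴ (1 − AᴴA) B ⪰ 0`. [folklore] -/
theorem IsContraction.mul {A B : Matrix n n ℂ} (hA : A.IsContraction) (hB : B.IsContraction) :
    (A * B).IsContraction := by
  have h : (1 : Matrix n n ℂ) - (A * B)ᴴ * (A * B) =
      ((1 : Matrix n n ℂ) - Bᴴ * B) + Bᴴ * ((1 : Matrix n n ℂ) - Aᴴ * A) * B := by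
    rw [conjTranspose_mul]
    noncomm_ring
  rw [IsContraction, h]
  exact hB.add (hA.conjTranspose_mul_mul_same B)

/-- Unit-modulus (or smaller) scalar multiples of contractions are contractions. [folklore] -/
theorem IsContraction.smul_of_norm_le_one {M : Matrix n n ℂ} (hM : M.IsContraction) {u : ℂ}
    (hu : ‖u‖ ≤ 1) : (u • M).IsContraction := by
  refine PosSemidef.of_dotProduct_mulVec_nonneg ?_ fun v => ?_
  · exact (isHermitian_one.sub (isHermitian_conjTranspose_mul_self _))
  · have h1 := hM.star_mulVec_dotProduct_le v
    have hnn : 0 ≤ star (M *ᵥ v) ⬝ᵥ (M *ᵥ v) := dotProduct_star_self_nonneg _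
    rw [sub_mulVec, dotProduct_sub, one_mulVec, ← mulVec_mulVec, dotProduct_mulVec, ← star_mulVec,
      smul_mulVec, star_smul, smul_dotProduct, dotProduct_smul, smul_smul, sub_nonneg]
    have hu2 : star u * u = ((‖u‖ ^ 2 : ℝ) : ℂ) := by
      rw [Complex.star_def, Complex.conj_mul', Complex.ofReal_pow]
    rw [hu2, smul_eq_mul]
    have hsq : (‖u‖ ^ 2 : ℝ) ≤ 1 := by
      have := mul_le_mul hu hu (norm_nonneg u) zero_le_one
      nlinarith
    calc ((‖u‖ ^ 2 : ℝ) : ℂ) * (star (M *ᵥ v) ⬝ᵥ (M *ᵥ v)) ≤ (1 : ℝ) * (star (M *ᵥ v) ⬝ᵥ (M *ᵥ v)) := by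
          exact mul_le_mul_of_nonneg_right (by exact_mod_cast hsq) hnn
      _ ≤ star v ⬝ᵥ v := by rw [Complex.ofReal_one, one_mul]; exact h1

/-- **`−‖v‖² ≤ Re ⟨v, M v⟩` for a contraction** (expand `0 ≤ ‖v + M v‖² ≤ 2‖v‖² + 2 Re⟨v, Mv⟩`).
[folklore] -/
theorem IsContraction.neg_re_le_re_quadForm {M : Matrix n n ℂ} (hM : M.IsContraction) (v : n → ℂ) :
    -(star v ⬝ᵥ v).re ≤ (star v ⬝ᵥ M *ᵥ v).re := by
  have h0 : 0 ≤ star (v + M *ᵥ v) ⬝ᵥ (v + M *ᵥ v) := dotProduct_star_self_nonneg _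
  have h1 := hM.star_mulVec_dotProduct_le v
  obtain ⟨h0re, -⟩ := Complex.nonneg_iff.mp h0
  obtain ⟨h1re, -⟩ := Complex.nonneg_iff.mp (sub_nonneg.mpr h1)
  have hexp : star (v + M *ᵥ v) ⬝ᵥ (v + M *ᵥ v) =
      star v ⬝ᵥ v + star v ⬝ᵥ M *ᵥ v + star (M *ᵥ v) ⬝ᵥ v + star (M *ᵥ v) ⬝ᵥ (M *ᵥ v) := by
    rw [star_add, add_dotProduct, dotProduct_add, dotProduct_add]; ring
  have hconj : star (M *ᵥ v) ⬝ᵥ v = star (star v ⬝ᵥ M *ᵥ v) := by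
    rw [star_dotProduct]
  rw [hexp, hconj] at h0re
  simp only [Complex.add_re, Complex.star_def, Complex.conj_re, Complex.sub_re] at h0re h1re
  linarith

/-- With a phase: `−‖a‖ Re⟨v,v⟩ ≤ Re (a ⟨v, M v⟩)` for a contraction `M` and any `a : ℂ`
(`a = ‖a‖ u`, `|u| = 1`, and `u M` is a contraction). [folklore] -/
theorem IsContraction.neg_norm_mul_le {M : Matrix n n ℂ} (hM : M.IsContraction) (a : ℂ) (v : n → ℂ) :
    -(‖a‖ * (star v ⬝ᵥ v).re) ≤ (a * (star v ⬝ᵥ M *ᵥ v)).re := by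
  by_cases ha : a = 0
  · subst ha; simp
  · have hapos : 0 < ‖a‖ := norm_pos_iff.mpr ha
    set u : ℂ := a / (‖a‖ : ℂ) with hu
    have hu1 : ‖u‖ ≤ 1 := by
      rw [hu, norm_div, Complex.norm_real, Real.norm_eq_abs, abs_of_pos hapos, div_self hapos.ne']
    have hau : a = (‖a‖ : ℂ) * u := by
      rw [hu, mul_div_cancel₀]; exact_mod_cast hapos.ne'
    have hc := (hM.smul_of_norm_le_one hu1).neg_re_le_re_quadForm v
    rw [smul_mulVec, dotProduct_smul, smul_eq_mul] at hc
    have key : (a * (star v ⬝ᵥ M *ᵥ v)).re = ‖a‖ * (u * (star v ⬝ᵥ M *ᵥ v)).re := by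
      rw [← Complex.re_ofReal_mul, ← mul_assoc, ← hau]
    rw [key]
    have := mul_le_mul_of_nonneg_left hc hapos.le
    linarith

/-- **Residual bound.** For contractions `Mₖ` and complex coefficients `aₖ` such that
`R = Σₖ aₖ Mₖ` is Hermitian, `R + (Σₖ ‖aₖ‖)·1 ⪰ 0` — the `ε`-shift of a rounded certificate whose
residual is expanded in monomials of norm at most one. KSDN (2024) §5.3.
[cite: KullEtAl2024, §5.3] -/
theorem posSemidef_sum_smul_add_of_isContraction {κ : Type*} (s : Finset κ)
    (M : κ → Matrix n n ℂ) (hM : ∀ k ∈ s, (M k).IsContraction) (a : κ → ℂ)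
    (hR : (∑ k ∈ s, a k • M k).IsHermitian) :
    (∑ k ∈ s, a k • M k + ((∑ k ∈ s, ‖a k‖ : ℝ) : ℂ) • (1 : Matrix n n ℂ)).PosSemidef := by
  have hH : (∑ k ∈ s, a k • M k + ((∑ k ∈ s, ‖a k‖ : ℝ) : ℂ) • (1 : Matrix n n ℂ)).IsHermitian := by
    refine hR.add ?_
    rw [IsHermitian, conjTranspose_smul, conjTranspose_one, Complex.star_def, Complex.conj_ofReal]
  refine PosSemidef.of_dotProduct_mulVec_nonneg hH fun v => ?_
  have him := Literature.MathematicalPhysics.QuantumLattice.im_quadForm_eq_zero hH v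
  refine Complex.nonneg_iff.mpr ⟨?_, him.symm⟩
  rw [add_mulVec, dotProduct_add, smul_mulVec, one_mulVec, dotProduct_smul, sum_mulVec,
    dotProduct_sum, Complex.add_re, Complex.re_sum, smul_eq_mul, Complex.re_ofReal_mul,
    Finset.sum_mul]
  have hterm : ∀ k ∈ s, -(‖a k‖ * (star v ⬝ᵥ v).re) ≤ (star v ⬝ᵥ (a k • M k) *ᵥ v).re := by
    intro k hk
    rw [smul_mulVec, dotProduct_smul, smul_eq_mul]
    exact (hM k hk).neg_norm_mul_le (a k) v
  have hsum := Finset.sum_le_sum hterm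
  rw [Finset.sum_neg_distrib] at hsum
  linarith

/-- Products (lists) of contractions are contractions. [folklore] -/
theorem isContraction_list_prod (l : List (Matrix n n ℂ)) (hl : ∀ M ∈ l, M.IsContraction) :
    l.prod.IsContraction := by
  induction l with
  | nil => simpa using isContraction_one
  | cons M l ih =>
      rw [List.prod_cons]
      exact (hl M (by simp)).mul (ih fun N hN => hl N (by simp [hN]))

end Matrix

/-! ### Fermionic creation and annihilation matrices are contractions -/

namespace Literature.MathematicalPhysics.QuantumLattice

open Matrix

variable {ι : Type*} [LinearOrder ι] [Fintype ι]

/-- `c_i` is a contraction: `1 − c_i† c_i = c_i c_i† = (c_i†)ᴴ c_i† ⪰ 0` by the CAR.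
Bratteli–Robinson II §5.2.2. [cite: BratteliRobinsonII1997, §5.2.2] -/
theorem isContraction_annihilation (i : ι) : (annihilation i).IsContraction := by
  have hcar := annihilation_mul_creation_add_creation_mul_annihilation_holds (ι := ι) i i
  rw [if_pos rfl] at hcar
  have h : (1 : Matrix (Finset ι) (Finset ι) ℂ) - (annihilation i)ᴴ * annihilation i =
      (creation i)ᴴ * creation i := by
    rw [annihilation_conjTranspose, creation_conjTranspose, ← hcar, add_sub_cancel_right]
  rw [Matrix.IsContraction, h]
  exact posSemidef_conjTranspose_mul_self _

/-- `c_i†` is a contraction: `1 − c_i c_i† = c_i† c_i = (c_i)ᴴ c_i ⪰ 0` by the CAR.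
Bratteli–Robinson II §5.2.2. [cite: BratteliRobinsonII1997, §5.2.2] -/
theorem isContraction_creation (i : ι) : (creation i).IsContraction := by
  have hcar := annihilation_mul_creation_add_creation_mul_annihilation_holds (ι := ι) i i
  rw [if_pos rfl] at hcar
  have h : (1 : Matrix (Finset ι) (Finset ι) ℂ) - (creation i)ᴴ * creation i =
      (annihilation i)ᴴ * annihilation i := by
    rw [annihilation_conjTranspose, creation_conjTranspose, ← hcar, add_sub_cancel_left]
  rw [Matrix.IsContraction, h]
  exact posSemidef_conjTranspose_mul_self _

/-- Every product of creation / annihilation matrices (a fermionic monomial, in any order) is a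
contraction; hence a Hermitian residual `R = Σₖ aₖ Mₖ` in such monomials satisfies
`R + (Σₖ ‖aₖ‖)·1 ⪰ 0` (`Matrix.posSemidef_sum_smul_add_of_isContraction`). [folklore] -/
theorem isContraction_prod_ladder (l : List (ι × Bool)) :
    (l.map fun p : ι × Bool => if p.2 then creation p.1 else annihilation p.1).prod.IsContraction := by
  refine Matrix.isContraction_list_prod _ fun M hM => ?_
  obtain ⟨p, -, rfl⟩ := List.mem_map.1 hM
  by_cases hp : p.2
  · simp only [hp, if_true]; exact isContraction_creation p.1
  · simp only [hp]; exact isContraction_annihilation p.1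

end Literature.MathematicalPhysics.QuantumLattice
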